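import Mathlib.NumberTheory.Zsqrtd.Basic
import Mathlib.RingTheory.Polynomial.Cyclotomic.Eval
import Mathlib.Algebra.Squarefree.Basic
import Mathlib.Data.Nat.Squarefree
import Mathlib.Data.ZMod.Basic
import Mathlib.Tactic.NormNum
import Mathlib.Tactic.Linarith
import Mathlib.Tactic.IntervalCases
import Mathlib.Tactic.Ring
import HarnessLib

set_option linter.dupNamespace false

/-!
# Weil-type family coverage — TYPE-III WINDOWS, part O (census block b04.26): the arithmetic of THEOREM S28 (rank-one law, cusp pieces, THEOREM X″ and its sign rule)

research route conditional on HC_CM; not a corollary; Q11.4-sentence-2 already refuted in dim ≥ 3.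

Ring 2, WEIL-TYPE FAMILY-COVERAGE CENSUS (`HOME/WEIL-FAMILY-COVERAGE.md` `## b04`, block b04.26, owner ring2-b04, gen 62; theory note
`HOME/pub-hodge-ring2-b04/census-g62/theory/THEOREMS-S28.md`).  SETTING (informal, NOT formalised): THEOREM S27 found six rigid four-point
families of `SL₂(9)`-curves whose hidden fourfold is a constant CM point `B₀ ∼ E⁴`; THEOREM S28 names the CM field of `E` (P38):
`ℚ(√−15)`, `ℚ(√−3)`, `ℚ(√−6)`, by (I) THEOREM X″ = ring2-b02's discriminant law X′ over the totally real centre `ℚ(√3)` refined modulo squares of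
totally positive elements, and (II) the cusp pieces of the family together with the rank-one law `K = ℚ(√−sqf ∏ ν(cⱼ))`.  THIS FILE checks the
finite arithmetic behind those statements: (1) the `ν`-table of `η` as values at 1 of cyclotomic polynomials and the products `∏ν` of the cusp
sides and of the `Σ`-cover, with their squarefree kernels 15, 3, 6 (`nu_*`, `prod_*`, `squarefree_*`); (2) the SIGN RULE in `ℤ[√3]`: `√3` has
norm `−3` (opposite signs at the two real places), multiplying by `√3` reverses the sign of the norm, `x² − 3y² = −1` is impossible (every unit
has norm `+1`), and `±√3` are the only square roots of 3 (`sqrt3_*`, `norm_mul_sqrt3`, `no_norm_neg_one`, `sq_eq_three`); (3) the admissibility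
checks at 3 and 5 deciding which imaginary quadratic fields embed in the quaternion algebra of discriminant 15 (`three_splits_*`, `*_inert_*`);
(4) the Chevalley–Weil / Riemann–Hurwitz bookkeeping of the three-point cusp curves (`cw_three_point`, `cusp_r_zero`, `genus_*`); (5) the
Hilbert class polynomial discriminants for `D = −15, −24` (`hilbert15_disc`, `hilbert24_disc`); (6) three point counts of the Bolza curve
`y² = x⁵ − x` used in the check of the rank-one law (`bolza_count_*`).  Nothing about covers, Jacobians, Hodge structures or quaternion
algebras is formalised; `HC_CM` is used nowhere.  No `sorry`, no definitions.
-/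

namespace Summit.HodgeConjecture.HodgeConjecture.Ring2.WeilCoverage.RankOneCM

/-! ## (1) The `ν`-table and the products -/

/-- `ν(3_2) = Φ₃(1) = 3` (eigenvalues `1,1,ω,ω̄` of `ρ_η` on the class `3_2`).
research route conditional on HC_CM; not a corollary; Q11.4-sentence-2 already refuted in dim ≥ 3. -/
theorem nu_three : (Polynomial.cyclotomic 3 ℤ).eval 1 = 3 := by
  have h := Polynomial.eval_one_cyclotomic_prime (R := ℤ) (p := 3)
  exact_mod_cast h

/-- `ν(5_10) = ν(5_11) = Φ₅(1) = 5` (the four primitive fifth roots of unity).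
research route conditional on HC_CM; not a corollary; Q11.4-sentence-2 already refuted in dim ≥ 3. -/
theorem nu_five : (Polynomial.cyclotomic 5 ℤ).eval 1 = 5 := by
  haveI : Fact (Nat.Prime 5) := ⟨by decide⟩
  have h := Polynomial.eval_one_cyclotomic_prime (R := ℤ) (p := 5)
  exact_mod_cast h

/-- `ν(8_4) = ν(8_7) = Φ₈(1) = 2` (the four primitive eighth roots of unity).
research route conditional on HC_CM; not a corollary; Q11.4-sentence-2 already refuted in dim ≥ 3. -/
theorem nu_eight : (Polynomial.cyclotomic 8 ℤ).eval 1 = 2 := by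
  have h := Polynomial.eval_one_cyclotomic_prime_pow (R := ℤ) (p := 2) 2
  norm_num at h
  exact h

/-- `Φ₄(1) = 2`, so `ν(4_6) = Φ₄(1)² = 4` (eigenvalues `i,i,−i,−i`) and a coset involution of `Σ` has `P = Φ₂(1)² = 4`.
research route conditional on HC_CM; not a corollary; Q11.4-sentence-2 already refuted in dim ≥ 3. -/
theorem nu_four : (Polynomial.cyclotomic 4 ℤ).eval 1 = 2 := by
  have h := Polynomial.eval_one_cyclotomic_prime_pow (R := ℤ) (p := 2) 1
  norm_num at h
  exact h

/-- `Φ₂(1) = 2` (eigenvalue `−1`): `ν(2_13) = 2⁴`, `ν(6_5) ⊇ 2²`, `P(x) = 2²` for a coset involution.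
research route conditional on HC_CM; not a corollary; Q11.4-sentence-2 already refuted in dim ≥ 3. -/
theorem nu_two : (Polynomial.cyclotomic 2 ℤ).eval 1 = 2 := by
  have h := Polynomial.eval_one_cyclotomic_prime (R := ℤ) (p := 2)
  exact_mod_cast h

/-- The rank-one `G`-sides of the `X(15)` family: `ν(3_2)·ν(5)·ν(3_3) = 3·5·9 = 15·3²`, and the `SL₂(5)/χ₄′`-sides: `3·5·4 = 15·2²`.
research route conditional on HC_CM; not a corollary; Q11.4-sentence-2 already refuted in dim ≥ 3. -/
theorem prod_X15 : 3 * 5 * 9 = 15 * 3 ^ 2 ∧ 3 * 5 * 4 = 15 * 2 ^ 2 := by norm_num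

/-- The rank-one sides of the `(10,10,3,3)` family: `ν(3_2)·ν(10)·ν(6_12) = 3·1·1 = 3` and `3·1·ν(4_6) = 3·2²`.
research route conditional on HC_CM; not a corollary; Q11.4-sentence-2 already refuted in dim ≥ 3. -/
theorem prod_j10 : 3 * 1 * 1 = 3 ∧ 3 * 1 * 4 = 3 * 2 ^ 2 := by norm_num

/-- The rank-one sides of the `(3,3,8,8)` family: `ν(8)·ν(3_2)·ν(3_3) = 2·3·9 = 6·3²`, `2·3·ν(6_12) = 6`, `2·3·ν(4_6) = 6·2²`.
research route conditional on HC_CM; not a corollary; Q11.4-sentence-2 already refuted in dim ≥ 3. -/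
theorem prod_j8 : 2 * 3 * 9 = 6 * 3 ^ 2 ∧ 2 * 3 * 1 = 6 ∧ 2 * 3 * 4 = 6 * 2 ^ 2 := by norm_num

/-- THEOREM X″ at the `Σ`-level (signature `(2,2,3,n)`): `P(x₁)P(x₂)P(y)P(z) = 4·4·3·5 = 15·4²`, `4·4·3·1 = 3·4²`, `4·4·3·2 = 6·4²`.
research route conditional on HC_CM; not a corollary; Q11.4-sentence-2 already refuted in dim ≥ 3. -/
theorem prod_sigma : 4 * 4 * 3 * 5 = 15 * 4 ^ 2 ∧ 4 * 4 * 3 * 1 = 3 * 4 ^ 2 ∧ 4 * 4 * 3 * 2 = 6 * 4 ^ 2 := by norm_num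

/-- The three kernels are squarefree: `d₀ ∈ {15, 3, 6}`.
research route conditional on HC_CM; not a corollary; Q11.4-sentence-2 already refuted in dim ≥ 3. -/
theorem squarefree_kernels : Squarefree (15 : ℕ) ∧ Squarefree (3 : ℕ) ∧ Squarefree (6 : ℕ) := by
  refine ⟨?_, ?_, ?_⟩
  · intro x hx
    have hle : x ≤ 15 := Nat.le_of_dvd (by norm_num) (dvd_trans (Dvd.intro x rfl) hx)
    interval_cases x <;> first | exact isUnit_one | exact absurd hx (by decide)
  · intro x hx
    have hle : x ≤ 3 := Nat.le_of_dvd (by norm_num) (dvd_trans (Dvd.intro x rfl) hx)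
    interval_cases x <;> first | exact isUnit_one | exact absurd hx (by decide)
  · intro x hx
    have hle : x ≤ 6 := Nat.le_of_dvd (by norm_num) (dvd_trans (Dvd.intro x rfl) hx)
    interval_cases x <;> first | exact isUnit_one | exact absurd hx (by decide)

/-- X″ over `ℚ(√5)` on the icosian sides: `(5 − √5)/2 · (5 + √5)/2 = 5` and `(3 + √5)/2 · (3 − √5)/2 = 1` (as identities `(5−s)(5+s) = 20`,
`(3+s)(3−s) = 4` for `s² = 5`), and over `ℚ(√2)` on the octahedral side `(2 − √2)(2 + √2) = 2`: the Frobenius-twin factors cancel.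
research route conditional on HC_CM; not a corollary; Q11.4-sentence-2 already refuted in dim ≥ 3. -/
theorem twin_factors_cancel (s t : ℝ) (hs : s ^ 2 = 5) (ht : t ^ 2 = 2) :
    (5 - s) * (5 + s) = 4 * 5 ∧ (3 + s) * (3 - s) = 4 * 1 ∧ (2 - t) * (2 + t) = 2 := by
  refine ⟨?_, ?_, ?_⟩
  · linear_combination (-1 : ℝ) * hs
  · linear_combination (-1 : ℝ) * hs
  · linear_combination (-1 : ℝ) * ht

/-! ## (2) The sign rule in `ℤ[√3]` -/

/-- `√3 · √3 = 3 = ⟨3, 0⟩` in `ℤ[√3]` (elements written `⟨a, b⟩ = a + b√3`).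
research route conditional on HC_CM; not a corollary; Q11.4-sentence-2 already refuted in dim ≥ 3. -/
theorem sqrt3_sq : (⟨0, 1⟩ : ℤ√3) * ⟨0, 1⟩ = ⟨3, 0⟩ := by
  ext <;> simp [Zsqrtd.re_mul, Zsqrtd.im_mul]

/-- `N(√3) = −3 < 0`: the two real embeddings of `√3` have opposite signs, so `√3` is not totally positive.
research route conditional on HC_CM; not a corollary; Q11.4-sentence-2 already refuted in dim ≥ 3. -/
theorem sqrt3_norm : Zsqrtd.norm (⟨0, 1⟩ : ℤ√3) = -3 := by
  simp [Zsqrtd.norm_def]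

/-- Multiplying by `√3` multiplies the norm by `−3`: `μ ↦ μ√3` exchanges «same sign at both places» and «opposite signs» — the mechanism of
the sign rule (`Δ̃ = d μ² = 3d (μ/√3)²`, exactly one of `μ`, `μ/√3` totally positive up to sign).
research route conditional on HC_CM; not a corollary; Q11.4-sentence-2 already refuted in dim ≥ 3. -/
theorem norm_mul_sqrt3 (μ : ℤ√3) : Zsqrtd.norm (μ * ⟨0, 1⟩) = -3 * Zsqrtd.norm μ := by
  rw [Zsqrtd.norm_mul, sqrt3_norm]; ring

/-- If `μ` has positive norm (same sign at both real places) then `μ√3` has negative norm (opposite signs).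
research route conditional on HC_CM; not a corollary; Q11.4-sentence-2 already refuted in dim ≥ 3. -/
theorem norm_mul_sqrt3_neg (μ : ℤ√3) (h : 0 < Zsqrtd.norm μ) : Zsqrtd.norm (μ * ⟨0, 1⟩) < 0 := by
  rw [norm_mul_sqrt3]; linarith

/-- `x² − 3y² = −1` has no integer solution (reduce mod 3: `−1` is not a square): every unit of `ℤ[√3]` has norm `+1`, so units do not
disturb the sign rule; the fundamental unit `2 + √3` has norm 1.
research route conditional on HC_CM; not a corollary; Q11.4-sentence-2 already refuted in dim ≥ 3. -/
theorem no_norm_neg_one (x y : ℤ) : x ^ 2 - 3 * y ^ 2 ≠ -1 := by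
  intro h
  have h3 : ((x : ZMod 3)) ^ 2 - 3 * ((y : ZMod 3)) ^ 2 = -1 := by
    have := congrArg (Int.cast : ℤ → ZMod 3) h
    push_cast at this
    exact this
  have hz : (3 : ZMod 3) = 0 := by decide
  rw [hz, zero_mul, sub_zero] at h3
  generalize (x : ZMod 3) = a at h3
  revert a; decide

/-- The fundamental unit: `(2 + √3)(2 − √3) = 1`, norm `+1`.
research route conditional on HC_CM; not a corollary; Q11.4-sentence-2 already refuted in dim ≥ 3. -/
theorem fundamental_unit : (⟨2, 1⟩ : ℤ√3) * ⟨2, -1⟩ = ⟨1, 0⟩ ∧ Zsqrtd.norm (⟨2, 1⟩ : ℤ√3) = 1 := by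
  constructor
  · ext <;> simp [Zsqrtd.re_mul, Zsqrtd.im_mul]
  · simp [Zsqrtd.norm_def]

/-- The only square roots of 3 in `ℤ[√3]` are `±√3` (so `3 ∉ (Z_{≫0})²`: the flipped candidates `5, 1, 2` of the sign rule are excluded).
research route conditional on HC_CM; not a corollary; Q11.4-sentence-2 already refuted in dim ≥ 3. -/
theorem sq_eq_three (a b : ℤ) (h : (⟨a, b⟩ : ℤ√3) * ⟨a, b⟩ = ⟨3, 0⟩) : a = 0 ∧ (b = 1 ∨ b = -1) := by
  have hre : a * a + 3 * (b * b) = 3 := by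
    have := congrArg Zsqrtd.re h; simp [Zsqrtd.re_mul] at this; linarith
  have him : a * b + b * a = 0 := by
    have := congrArg Zsqrtd.im h; simp [Zsqrtd.im_mul] at this; linarith
  have hab : a * b = 0 := by linarith
  rcases mul_eq_zero.mp hab with ha | hb
  · subst ha
    have hb2 : b * b = 1 := by linarith
    have hb1 : b ≤ 1 := by nlinarith
    have hb0 : -1 ≤ b := by nlinarith
    refine ⟨rfl, ?_⟩
    interval_cases b <;> simp_all
  · subst hb
    have : a * a = 3 := by linarith
    have ha1 : a ≤ 2 := by nlinarith
    have ha0 : -2 ≤ a := by nlinarith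
    interval_cases a <;> omega

/-! ## (3) Admissibility at the primes 3 and 5 of `B₁₅` -/

/-- `−5` is a non-zero square mod 3 (`−5 ≡ 1`): 3 SPLITS in `ℚ(√−5)`, so `ℚ(√−5)` does not embed in the quaternion algebra of
discriminant 15 and `E_{√−5}⁴` is not a CM point of `X(15)` — the flipped sign rule is refuted on the `X(15)` family.
research route conditional on HC_CM; not a corollary; Q11.4-sentence-2 already refuted in dim ≥ 3. -/
theorem three_splits_minus5 : ∃ x : ZMod 3, x ≠ 0 ∧ x ^ 2 = -5 := ⟨1, by decide, by decide⟩

/-- `−2 ≡ 1 mod 3` is a non-zero square: 3 splits in `ℚ(√−2)` (the flipped candidate at the `(5,5,4)` cusps is refuted too).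
research route conditional on HC_CM; not a corollary; Q11.4-sentence-2 already refuted in dim ≥ 3. -/
theorem three_splits_minus2 : ∃ x : ZMod 3, x ≠ 0 ∧ x ^ 2 = -2 := ⟨1, by decide, by decide⟩

/-- `−10 ≡ 2 mod 3` is not a square: 3 is INERT in `ℚ(√−10)` (the boundary field `ℚ(√−10)` of the dominant `X(15)` orbit is admissible; 5 ramifies).
research route conditional on HC_CM; not a corollary; Q11.4-sentence-2 already refuted in dim ≥ 3. -/
theorem three_inert_minus10 : ¬ ∃ x : ZMod 3, x ^ 2 = -10 := by decide

/-- `−3 ≡ 2 mod 5` is not a square: 5 is INERT in `ℚ(√−3)` (and 3 ramifies), so `ℚ(√−3)` IS an admissible CM field on `X(15)` — admissibility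
alone could not have decided P38 on the `X(15)` family; the rank-one pieces do.
research route conditional on HC_CM; not a corollary; Q11.4-sentence-2 already refuted in dim ≥ 3. -/
theorem five_inert_minus3 : ¬ ∃ x : ZMod 5, x ^ 2 = -3 := by decide

/-- 3 and 5 ramify in `ℚ(√−15)` and `ℚ(√−30)` (`15 ≡ 30 ≡ 0` mod 3 and mod 5): both admissible on `X(15)`.
research route conditional on HC_CM; not a corollary; Q11.4-sentence-2 already refuted in dim ≥ 3. -/
theorem ramified_15_30 : (15 : ZMod 3) = 0 ∧ (15 : ZMod 5) = 0 ∧ (30 : ZMod 3) = 0 ∧ (30 : ZMod 5) = 0 := by decide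

/-! ## (4) Chevalley–Weil and Riemann–Hurwitz bookkeeping of the cusp sides -/

/-- Chevalley–Weil for a three-point cover: the multiplicity of `χ` in `H¹` is `f − Σ fix = 2Σw − 2f` when `2w = f − fix`.
research route conditional on HC_CM; not a corollary; Q11.4-sentence-2 already refuted in dim ≥ 3. -/
theorem cw_three_point (f w₁ w₂ w₃ x₁ x₂ x₃ : ℤ) (h₁ : 2 * w₁ = f - x₁) (h₂ : 2 * w₂ = f - x₂) (h₃ : 2 * w₃ = f - x₃) :
    f - (x₁ + x₂ + x₃) = 2 * (w₁ + w₂ + w₃) - 2 * f := by omega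

/-- `r = 0` at a cusp: the two sides' multiplicities add up to `2k = 4` — the side types of the rigid orbits: `(m_a, m_b) ∈ {(2,2), (0,4), (4,0)}`;
e.g. `G (3,5,3_3)`: `w = 1,2,2`, `m = 2(5 − 4) = 2`; `G (5,5,6_5)`: `2(6 − 4) = 4`; `C₃² (3,3,3)`: `m = 0`.
research route conditional on HC_CM; not a corollary; Q11.4-sentence-2 already refuted in dim ≥ 3. -/
theorem cusp_r_zero : 2 * ((1 + 2 + 2) - 4) = 2 ∧ 2 * ((2 + 2 + 2) - 4) = 4 ∧ 2 + 2 = 4 ∧ 0 + 4 = 4 := by norm_num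

/-- Riemann–Hurwitz genera of the rank-one `SL₂(9)`-sides: signatures `(3,5,3)`, `(3,10,6)`, `(8,3,3)`, `(8,3,6)` give `g = 49, 145, 76, 136`
(`2g − 2 = |G|(1 − Σ 1/mⱼ)`).
research route conditional on HC_CM; not a corollary; Q11.4-sentence-2 already refuted in dim ≥ 3. -/
theorem genus_G_sides :
    720 - (720 / 3 + 720 / 5 + 720 / 3) = 2 * 49 - 2 ∧ 720 - (720 / 3 + 720 / 10 + 720 / 6) = 2 * 145 - 2 ∧
    720 - (720 / 8 + 720 / 3 + 720 / 3) = 2 * 76 - 2 ∧ 720 - (720 / 8 + 720 / 3 + 720 / 6) = 2 * 136 - 2 := by norm_num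

/-- Genera of the other cusp curves: `SL₂(5)` `(3,5,4)`, `(5,5,3)`, `(3,10,4)`, `(10,10,3)` → `14, 17, 20, 29`; `2O` `(8,3,4)`, `(8,8,3)` → `8, 11`;
`3²:8` `(8,8,6)` → `22`; `SL₂(3)` `(3,3,6)` → `3`; `C₃²` `(3,3,3)` → `1` (Fermat cubic); `Q₈` `(4,4,4)` → `2` (Bolza).
research route conditional on HC_CM; not a corollary; Q11.4-sentence-2 already refuted in dim ≥ 3. -/
theorem genus_small_sides :
    120 - (120 / 3 + 120 / 5 + 120 / 4) = 2 * 14 - 2 ∧ 120 - (120 / 5 + 120 / 5 + 120 / 3) = 2 * 17 - 2 ∧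
    120 - (120 / 3 + 120 / 10 + 120 / 4) = 2 * 20 - 2 ∧ 120 - (120 / 10 + 120 / 10 + 120 / 3) = 2 * 29 - 2 ∧
    48 - (48 / 8 + 48 / 3 + 48 / 4) = 2 * 8 - 2 ∧ 48 - (48 / 8 + 48 / 8 + 48 / 3) = 2 * 11 - 2 ∧
    72 - (72 / 8 + 72 / 8 + 72 / 6) = 2 * 22 - 2 ∧ 24 - (24 / 3 + 24 / 3 + 24 / 6) = 2 * 3 - 2 ∧
    9 - (9 / 3 + 9 / 3 + 9 / 3) = 2 * 1 - 2 ∧ 8 - (8 / 4 + 8 / 4 + 8 / 4) = 2 * 2 - 2 := by norm_num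

/-- The cusp count: a rigid orbit with `|O|` nodes has `4|O|` (node, adjacent pair) cusps: `240, 240, 384`; rank-one ℚ-pieces occur at
`160, 160, 256` of them (two thirds).
research route conditional on HC_CM; not a corollary; Q11.4-sentence-2 already refuted in dim ≥ 3. -/
theorem cusp_counts : 4 * 60 = 240 ∧ 4 * 96 = 384 ∧ 3 * 160 = 2 * 240 ∧ 3 * 256 = 2 * 384 := by norm_num

/-! ## (5) The CM curves -/

/-- `H_{−15}(X) = X² + 191025X − 121287375` has discriminant `5·85995²`: `j = (−191025 ± 85995√5)/2`.
research route conditional on HC_CM; not a corollary; Q11.4-sentence-2 already refuted in dim ≥ 3. -/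
theorem hilbert15_disc : (191025 : ℤ) ^ 2 + 4 * 121287375 = 5 * 85995 ^ 2 := by norm_num

/-- `H_{−24}(X) = X² − 4834944X + 14670139392` has discriminant `2·(2·1707264)²`: `j = 2417472 ± 1707264√2`.
research route conditional on HC_CM; not a corollary; Q11.4-sentence-2 already refuted in dim ≥ 3. -/
theorem hilbert24_disc : (4834944 : ℤ) ^ 2 - 4 * 14670139392 = 2 * (2 * 1707264) ^ 2 ∧ (4834944 : ℤ) = 2 * 2417472 := by norm_num

/-! ## (6) The Bolza check of the rank-one law -/

/-- `#C(𝔽₃) = 4` for `y² = x⁵ − x`: 3 affine points plus the point at infinity.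
research route conditional on HC_CM; not a corollary; Q11.4-sentence-2 already refuted in dim ≥ 3. -/
theorem bolza_count_3 : (Finset.univ.filter (fun q : ZMod 3 × ZMod 3 => q.2 ^ 2 = q.1 ^ 5 - q.1)).card + 1 = 4 := by decide

/-- `#C(𝔽₇) = 8` for `y² = x⁵ − x` (`a₁ = 0`: 7 is inert in `ℚ(√−2)`, supersingular reduction).
research route conditional on HC_CM; not a corollary; Q11.4-sentence-2 already refuted in dim ≥ 3. -/
theorem bolza_count_7 : (Finset.univ.filter (fun q : ZMod 7 × ZMod 7 => q.2 ^ 2 = q.1 ^ 5 - q.1)).card + 1 = 8 := by decide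

/-- The `p = 17` factorisation used in the check: `a₁ = −12 = 2·(−6)`, `a₂ = 70 = 36 + 2·17`, and `6² − 4·17 = −2·4²` (`17 = 3² + 2·2²`): both
Frobenius eigenvalue pairs lie in `ℚ(√−2)`.
research route conditional on HC_CM; not a corollary; Q11.4-sentence-2 already refuted in dim ≥ 3. -/
theorem bolza_17 : (-12 : ℤ) = 2 * (-6) ∧ (70 : ℤ) = (-6) * (-6) + 2 * 17 ∧ (6 : ℤ) ^ 2 - 4 * 17 = -2 * 4 ^ 2 ∧ (17 : ℤ) = 3 ^ 2 + 2 * 2 ^ 2 := by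
  norm_num

/-- The `a₁ = 0` cases: `a₂² − 4p² ∈ −2·□` at the split primes `3, 11, 19, 43` (`a₂ = −2, 14, −34, 14`).
research route conditional on HC_CM; not a corollary; Q11.4-sentence-2 already refuted in dim ≥ 3. -/
theorem bolza_split_a1_zero :
    ((-2 : ℤ) ^ 2 - 4 * 3 ^ 2 = -2 * 4 ^ 2) ∧ ((14 : ℤ) ^ 2 - 4 * 11 ^ 2 = -2 * 12 ^ 2) ∧
    ((-34 : ℤ) ^ 2 - 4 * 19 ^ 2 = -2 * 12 ^ 2) ∧ ((14 : ℤ) ^ 2 - 4 * 43 ^ 2 = -2 * 60 ^ 2) := by norm_num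

end Summit.HodgeConjecture.HodgeConjecture.Ring2.WeilCoverage.RankOneCM
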